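import Literature.Geometry.Riemannian.HeatKernelStrongFeller
import Literature.Geometry.Riemannian.HeatKernelDuality
import Literature.Geometry.Lorentzian.VolumePositivity
import Mathlib.MeasureTheory.Measure.Decomposition.RadonNikodym
import Mathlib.MeasureTheory.VectorMeasure.Decomposition.RadonNikodym
import HarnessLib

/-!
# Absolute continuity of the heat kernel measures of a Ricci flow and their Radon–Nikodym
# densities (Bamler 2020a, §2.3)

R. Bamler, *Entropy and heat kernel bounds on a Ricci flow background*, arXiv:2008.07093 (2020a),
§2.3: the conjugate heat kernel measures of a Ricci flow on a closed manifold are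
`dν_{x,t;s} := K(x,t;·,s) dg_s` with `K` the (smooth, positive) heat kernel. The tree built the
measures `ν_{x,r;s}` (`heatKernelMeasure`, `HeatKernelMeasures.lean`) WITHOUT a density, by
Riesz–Markov–Kakutani from the solution operator. This file is the first step towards `K`: for a
`C^∞` family `h` of Riemannian metrics on a closed manifold `M` (modelled on `ℝᵐ`) which is a Ricci
flow on `[s, t]`, and `s < r ≤ t`,

* `IsRicciFlow.heatKernelMeasure_apply_eq_zero`,
  `IsRicciFlow.heatKernelMeasure_absolutelyContinuous` — **`ν_{x,r;s} ≪ V_{h(s)}` for EVERY base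
  point `x`**: a `V_{h(s)}`-null Borel set `S` is `ν_{x,r;s}`-null for `V_{h(r)}`-a.e. `x`
  (duality, `IsRicciFlow.heatKernelMeasure_apply_eq_zero_ae`, `HeatKernelDuality.lean`),
  `x ↦ ν_{x,r;s}(S)` is continuous (strong Feller property,
  `IsRicciFlow.continuous_heatKernelMeasure_apply`, `HeatKernelStrongFeller.lean`), and the
  Riemannian volume charges nonempty open sets (`isOpenPosMeasure_riemannianMeasure`,
  `VolumePositivity.lean`), so the open set `{x | ν_{x,r;s}(S) ≠ 0}` is empty;
* `IsRicciFlow.withDensity_rnDeriv_heatKernelMeasure` — the Radon–Nikodym representation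
  `ν_{x,r;s} = (dν_{x,r;s}/dV_{h(s)}) · V_{h(s)}` (the a.e.-defined heat kernel `K(x,r;·,s)`);
* `IsRicciFlow.lintegral_rnDeriv_heatKernelMeasure` — `∫ (dν_{x,r;s}/dV_{h(s)}) dV_{h(s)} = 1`
  (Bamler 2023, §3.7: `∫_M K(x,t;·,s) dg_s = 1`);
* `IsRicciFlow.integral_eq_integral_rnDeriv_mul` —
  `∫ φ dν_{x,r;s} = ∫ (dν_{x,r;s}/dV_{h(s)}) φ dV_{h(s)}` for `ν_{x,r;s}`-integrable `φ`.

What is NOT here: the smoothness and positivity of the density, its symmetry properties, and its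
dependence on `(x, r)` (the genuine heat kernel `K(x,r;y,s)` as a smooth function of all
variables). Everything is proved; no definitions, no named facts.

## References

* R. H. Bamler, *Entropy and heat kernel bounds on a Ricci flow background*, arXiv:2008.07093
  (2020), §2.3 (`K(x,t;y,s)`, `dν_{x,t;s} := K(x,t;·,s) dg_s`). [Bamler2020Entropy]
* R. H. Bamler, *Compactness theory of the space of super Ricci flows*, Invent. Math. 233 (2023),
  1121–1277, §3.1, Def. 3.2 and the remark following it; §3.7. [Bamler2023]
-/

open Set Filter MeasureTheory MeasureTheory.Measure
open scoped ENNReal Topology Manifold ContDiff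

namespace Literature.Geometry.Riemannian

open Lorentzian Lorentzian.PseudoRiemannianMetric

section AbsCont

variable {m : ℕ} {H : Type*} [TopologicalSpace H]
  {I : ModelWithCorners ℝ (EuclideanSpace ℝ (Fin m)) H} [I.Boundaryless]
  {M : Type*} [TopologicalSpace M] [ChartedSpace H M] [IsManifold I ∞ M]
  [T2Space M] [CompactSpace M] [SecondCountableTopology M] [MeasurableSpace M] [BorelSpace M]
  {h : ℝ → PseudoRiemannianMetric I ∞ (EuclideanSpace ℝ (Fin m)) (TangentSpace I : M → Type _)}
  (hh : IsContMDiffFamilyOn ∞ h univ) (hR : ∀ r, (h r).IsRiemannian)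

/-- **Null sets of `V_{h(s)}` are `ν_{x,r;s}`-null for EVERY `x`**: for a Ricci flow on `[s, t]`,
`s < r ≤ t`, and a Borel set `S` with `V_{h(s)}(S) = 0`, `ν_{x,r;s}(S) = 0` for all `x ∈ M`.
The function `x ↦ ν_{x,r;s}(S)` vanishes `V_{h(r)}`-a.e. (duality,
`IsRicciFlow.heatKernelMeasure_apply_eq_zero_ae` for the flow restricted to `[s, r]`), is
continuous (strong Feller property, `IsRicciFlow.continuous_heatKernelMeasure_apply`), and the
Riemannian measure charges nonempty open sets (`isOpenPosMeasure_riemannianMeasure`); so it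
vanishes identically (Bamler 2020a, §2.3: `dν_{x,t;s} = K(x,t;·,s) dg_s`).
[cite: Bamler2020Entropy, §2.3] -/
theorem IsRicciFlow.heatKernelMeasure_apply_eq_zero {s t : ℝ}
    {cov : ℝ → CovariantDerivative I (EuclideanSpace ℝ (Fin m)) (TangentSpace I : M → Type _)}
    (hflow : IsRicciFlow h cov (Icc s t)) {r : ℝ} (hr : r ∈ Ioc s t) {S : Set M}
    (hS : MeasurableSet S) (hS0 : (h s).riemVolume S = 0) (x : M) :
    heatKernelMeasure hh hR r x s S = 0 := by
  -- a.e. vanishing for the flow on `[s, r]`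
  have hae : ∀ᵐ y ∂(h r).riemVolume, heatKernelMeasure hh hR r y s S = 0 :=
    (hflow.mono (Icc_subset_Icc le_rfl hr.2)).heatKernelMeasure_apply_eq_zero_ae hh hR hr.1 hS hS0
  -- continuity in the base point (strong Feller)
  have hcont : Continuous fun y ↦ heatKernelMeasure hh hR r y s S :=
    hflow.continuous_heatKernelMeasure_apply hh hR (hr.1.trans_le hr.2) hS hr
  -- the Riemannian volume is positive on nonempty open sets
  haveI : (h r).riemVolume.IsOpenPosMeasure := by
    rw [riemVolume_eq (hR r)]
    exact isOpenPosMeasure_riemannianMeasure _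
  exact congrFun (Measure.eq_of_ae_eq hae hcont continuous_const) x

/-- **Absolute continuity of the heat kernel measures** (Bamler 2020a, §2.3:
`dν_{x,t;s} = K(x,t;·,s) dg_s`): for a Ricci flow on `[s, t]` and `s < r ≤ t`,
`ν_{x,r;s} ≪ V_{h(s)}` for every `x ∈ M`. [cite: Bamler2020Entropy, §2.3] -/
theorem IsRicciFlow.heatKernelMeasure_absolutelyContinuous {s t : ℝ}
    {cov : ℝ → CovariantDerivative I (EuclideanSpace ℝ (Fin m)) (TangentSpace I : M → Type _)}
    (hflow : IsRicciFlow h cov (Icc s t)) {r : ℝ} (hr : r ∈ Ioc s t) (x : M) :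
    heatKernelMeasure hh hR r x s ≪ (h s).riemVolume :=
  Measure.AbsolutelyContinuous.mk fun _S hS hS0 ↦
    hflow.heatKernelMeasure_apply_eq_zero hh hR hr hS hS0 x

/-- **The Radon–Nikodym density of the heat kernel measure** (the heat kernel `K(x,r;·,s)` of
Bamler 2020a, §2.3, as an a.e.-defined density): for a Ricci flow on `[s, t]` and `s < r ≤ t`,
`ν_{x,r;s} = (dν_{x,r;s}/dV_{h(s)}) · V_{h(s)}` (Radon–Nikodym theorem for the finite measures
`ν_{x,r;s} ≪ V_{h(s)}`). [cite: Bamler2020Entropy, §2.3] -/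
theorem IsRicciFlow.withDensity_rnDeriv_heatKernelMeasure {s t : ℝ}
    {cov : ℝ → CovariantDerivative I (EuclideanSpace ℝ (Fin m)) (TangentSpace I : M → Type _)}
    (hflow : IsRicciFlow h cov (Icc s t)) {r : ℝ} (hr : r ∈ Ioc s t) (x : M) :
    (h s).riemVolume.withDensity ((heatKernelMeasure hh hR r x s).rnDeriv (h s).riemVolume) =
      heatKernelMeasure hh hR r x s := by
  haveI : IsFiniteMeasure (h s).riemVolume := ⟨(h s).riemVolume_univ_lt_top⟩
  exact Measure.withDensity_rnDeriv_eq _ _ (hflow.heatKernelMeasure_absolutelyContinuous hh hR hr x)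

/-- **The heat kernel density has total mass one**: `∫ (dν_{x,r;s}/dV_{h(s)}) dV_{h(s)} = 1` for a
Ricci flow on `[s, t]`, `s < r ≤ t` (Bamler 2023, §3.7: `∫_M K(x,t;·,s) dg_s = 1`; here from the
Radon–Nikodym representation of the probability measure `ν_{x,r;s}`). [cite: Bamler2023, §3.7] -/
theorem IsRicciFlow.lintegral_rnDeriv_heatKernelMeasure {s t : ℝ}
    {cov : ℝ → CovariantDerivative I (EuclideanSpace ℝ (Fin m)) (TangentSpace I : M → Type _)}
    (hflow : IsRicciFlow h cov (Icc s t)) {r : ℝ} (hr : r ∈ Ioc s t) (x : M) :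
    ∫⁻ y, (heatKernelMeasure hh hR r x s).rnDeriv (h s).riemVolume y ∂(h s).riemVolume = 1 := by
  haveI : IsFiniteMeasure (h s).riemVolume := ⟨(h s).riemVolume_univ_lt_top⟩
  rw [Measure.lintegral_rnDeriv (hflow.heatKernelMeasure_absolutelyContinuous hh hR hr x),
    measure_univ]

/-- **Integration against the heat kernel measure is integration against its density**: for a
Ricci flow on `[s, t]`, `s < r ≤ t`, and a `ν_{x,r;s}`-integrable `φ`,
`∫ φ dν_{x,r;s} = ∫ (dν_{x,r;s}/dV_{h(s)}) φ dV_{h(s)}` (Bamler 2020a, §2.3: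
`u(x,t) = ∫ K(x,t;y,s) u(y,s) dg_s(y)`; the signed measures `φ · ν_{x,r;s}` and
`((dν_{x,r;s}/dV_{h(s)}) φ) · V_{h(s)}` coincide, `withDensityᵥ_rnDeriv_smul`, and are evaluated on
`M`). [cite: Bamler2020Entropy, §2.3] -/
theorem IsRicciFlow.integral_eq_integral_rnDeriv_mul {s t : ℝ}
    {cov : ℝ → CovariantDerivative I (EuclideanSpace ℝ (Fin m)) (TangentSpace I : M → Type _)}
    (hflow : IsRicciFlow h cov (Icc s t)) {r : ℝ} (hr : r ∈ Ioc s t) (x : M) {φ : M → ℝ}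
    (hφ : Integrable φ (heatKernelMeasure hh hR r x s)) :
    ∫ y, φ y ∂(heatKernelMeasure hh hR r x s) =
      ∫ y, ((heatKernelMeasure hh hR r x s).rnDeriv (h s).riemVolume y).toReal * φ y
        ∂(h s).riemVolume := by
  haveI : IsFiniteMeasure (h s).riemVolume := ⟨(h s).riemVolume_univ_lt_top⟩
  have hac := hflow.heatKernelMeasure_absolutelyContinuous hh hR hr x
  -- the `V_{h(s)}`-integrability of the right-hand integrand
  have hφ' : Integrable (fun y ↦
      ((heatKernelMeasure hh hR r x s).rnDeriv (h s).riemVolume y).toReal * φ y)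
      (h s).riemVolume := (integrable_toReal_rnDeriv_mul_iff hac).2 hφ
  -- the two signed measures with these densities coincide; evaluate them on `univ`
  have key := congrArg (fun w : VectorMeasure M ℝ ↦ w univ) (withDensityᵥ_rnDeriv_smul hac hφ)
  simp only [smul_eq_mul] at key
  rw [withDensityᵥ_apply hφ' MeasurableSet.univ, withDensityᵥ_apply hφ MeasurableSet.univ,
    setIntegral_univ, setIntegral_univ] at key
  exact key.symm

end AbsCont

end Literature.Geometry.Riemannian
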